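import Summits.BirchSwinnertonDyer.BirchSwinnertonDyer.Theorems.EisensteinPrimesBSDpOnCellCTelescopeBranchIsogenyOfIntertwiner
import Summits.BirchSwinnertonDyer.BirchSwinnertonDyer.Theorems.EisensteinPrimesBSDpOnCellCTelescopeBranchIntegralIntertwiner
import Literature.NumberTheory.EllipticCurves.PrimaryTorsionGaloisRep
import Literature.NumberTheory.EllipticCurves.TateModule
import Mathlib.LinearAlgebra.Matrix.ToLin
import HarnessLib

/-!
# [telescope — width x2-p2 g23, 2026-08-30] THE `X = 0` COLUMN UP TO ADAPTER-T: rational CONJUGACY (over ℚ_p) of the reduction `ρ mod X` to a framed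
# ℤ_p-representation `M₂` realised on a target `T` by a bijective equivariant `t : (ℚ_p/ℤ_p)ⁿ → T` ⟹ the ISOGENY `e₀ : (ℚ_p/ℤ_p)ⁿ → T` intertwining
# `ρ mod X` with the target action (finite kernel and cokernel) — with `T = E(ℚ̄)[p^∞]`, `M₂ = [T_pE]_b`, `t` = ADAPTER-T (ideator g42) this is T-GAL's
# (G-fib₀) ⟹ the ℚ-level `X = 0` clause of leaf N1♭
# Crux 4 `BSDpOnCellC` (stmt-BirchSwinnertonDyer-19034), line «telescope», leaf N1 (`--supports`, helper; closes nothing)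

WHY: symmetric to #9 `TelescopeBranchMemberIsogenyOfConj` (member column). T-GAL (ideator g41, `Cruxes/BSDpOnCellC/T-GAL-FACTTEXT.md` §3a) states
(G-fib₀) as `((ρ σ).map constantCoeff).map coe = P · [T_pE σ]_b · P⁻¹` over `ℚ_p` for a ℤ_p-basis `b` of `W.tateModule p`. The pieces: ideator g41's H2
`TelescopeBranchIntegralIntertwiner.exists_integral_intertwiner` (⟹ integral `Q, Q'`, `p^c`), this seat's #4 (⟹ isogeny of `(ℚ_p/ℤ_p)ⁿ` intertwining
`M₁` with `M₂`), and ADAPTER-T (g42, announced 09:07:48Z: `t_b : (Fin 2 → QpModZp p) → E(ℚ̄)[p^∞]` bijective, ℤ_p-linear, `[T_pE]_b ↦ σ •`). This file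
composes the first two with ANY such target adapter `t` (hypothesis), so that when ADAPTER-T lands the ℚ-level `X = 0` clause `hfd₀` of #7
`TelescopeBranchLatticeRestrict.branchLattice_conclusion_of_framed_rat` follows by one application (`exists_fd0_isogeny_of_conj_of_adapter`).

CONTENT (namespace `…Theorems.TelescopeBranchCurveIsogenyOfConj`; THEOREMS ONLY): **`exists_isogeny_of_conj_of_adapter`** (generic `G`, target `T`
with ℤ_p-scalars and an action `act`) and **`exists_fd0_isogeny_of_conj_of_adapter`** (T-GAL (G-fib₀) currency: `ρ : FramedGaloisRep ℚ ℤ_p⟦X⟧ n`,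
`b : Module.Basis (Fin n) ℤ_[p] (W.tateModule p)`, `P : GL (Fin n) ℚ_[p]`, target `PrimaryTorsion W.geomPoints p` with `W.primaryTorsionGaloisRep p`).

HONEST FRAMING: composition only; ADAPTER-T is a HYPOTHESIS here, not proved; constructs no Galois representation; closes no registered stub, no crux,
no summit statement; BSD is proved for no curve by this file. No named fact, no definition, no instance, no `sorry`.
References (shape only): [cite: Hida1986, Thm. 2.1 (2.2c)] [cite: Greenberg1989, §1 p. 98]
-/

set_option autoImplicit false
set_option linter.dupNamespace false

noncomputable section

open scoped Classical MatrixGroups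
open Finset
open Literature.NumberTheory.EllipticCurves Literature.NumberTheory.GaloisRepresentations Literature.NumberTheory.IwasawaTheory
  Summit.BirchSwinnertonDyer.BirchSwinnertonDyer.Theorems.TelescopeBranchIsogenyOfIntertwiner

namespace Summit.BirchSwinnertonDyer.BirchSwinnertonDyer.Theorems.TelescopeBranchCurveIsogenyOfConj

universe u v

variable {p : ℕ} [Fact p.Prime] {n : ℕ}

/-- **Rational conjugacy + a bijective equivariant target adapter ⟹ isogeny into the target.** If ℤ_p-matrices `M₁ g` are conjugate over `ℚ_p` to
`M₂ g` (`M₁ g = P M₂ g P⁻¹`) and `t : (ℚ_p/ℤ_p)ⁿ → T` is additive, ℤ_p-linear, bijective, with `t (M₂ g · v) = act g (t v)`, then there is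
`e : (ℚ_p/ℤ_p)ⁿ → T`, ℤ_p-linear, with `e (M₁ g · v) = act g (e v)`, finite kernel and finite cokernel (`e := t ∘ e_{Q'}`, `Q' M₁ = M₂ Q'`).
[cite: Hida1986, Thm. 2.1 (2.2c)] [cite: Greenberg1989, §1 p. 98] -/
theorem exists_isogeny_of_conj_of_adapter {G : Type u} (M₁ M₂ : G → Matrix (Fin n) (Fin n) ℤ_[p]) (P : GL (Fin n) ℚ_[p])
    (h : ∀ g, (M₁ g).map ((↑) : ℤ_[p] → ℚ_[p]) =
      (P : Matrix (Fin n) (Fin n) ℚ_[p]) * (M₂ g).map ((↑) : ℤ_[p] → ℚ_[p]) * ((P⁻¹ : GL (Fin n) ℚ_[p]) : Matrix (Fin n) (Fin n) ℚ_[p]))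
    {T : Type v} [AddCommGroup T] [Module ℤ_[p] T] (act : G → T → T) (t : (Fin n → QpModZp p) →+ T)
    (htlin : ∀ (c : ℤ_[p]) (v : Fin n → QpModZp p), t (c • v) = c • t v) (htinj : Function.Injective t) (htsurj : Function.Surjective t)
    (hteq : ∀ (g : G) (v : Fin n → QpModZp p), t (fun i ↦ ∑ j, M₂ g i j • v j) = act g (t v)) :
    ∃ e : (Fin n → QpModZp p) →+ T,
      (∀ (c : ℤ_[p]) (v : Fin n → QpModZp p), e (c • v) = c • e v) ∧
      (∀ (g : G) (v : Fin n → QpModZp p), e (fun i ↦ ∑ j, M₁ g i j • v j) = act g (e v)) ∧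
      Finite e.ker ∧ Finite (T ⧸ e.range) := by
  obtain ⟨Q, Q', c, hQQ', hQ'Q, hint⟩ := TelescopeBranchIntegralIntertwiner.exists_integral_intertwiner M₁ M₂ P h
  obtain ⟨e₁, he₁, he₁lin, he₁ker, he₁surj⟩ := exists_isogeny_of_intertwiner (p := p) Q' Q hQ'Q hQQ'
  have he₁eq : ∀ (g : G) (v : Fin n → QpModZp p), e₁ (fun i ↦ ∑ j, M₁ g i j • v j) = fun i ↦ ∑ j, M₂ g i j • e₁ v j :=
    mulVec_intertwines M₂ M₁ Q' (fun g ↦ ((hint g).2).symm) e₁ he₁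
  refine ⟨t.comp e₁, fun c v ↦ ?_, fun g v ↦ ?_, finite_ker_comp_of_injective e₁ t he₁ker htinj, ?_⟩
  · rw [AddMonoidHom.comp_apply, AddMonoidHom.comp_apply, he₁lin, htlin]
  · rw [AddMonoidHom.comp_apply, AddMonoidHom.comp_apply, he₁eq, hteq]
  · have hs : Function.Surjective (t.comp e₁) := htsurj.comp he₁surj
    rw [AddMonoidHom.range_eq_top.mpr hs]
    infer_instance

/-- **The ℚ-level `X = 0` clause of leaf N1♭ from T-GAL's (G-fib₀), MODULO ADAPTER-T.** For a framed `ρ : Γ_ℚ →ₜ* GL_n(ℤ_p⟦X⟧)`, a ℤ_p-basis `b` of the Tate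
module `W.tateModule p` and `P ∈ GL_n(ℚ_p)` with `((ρ σ).map constantCoeff) = P [T_p σ]_b P⁻¹` over `ℚ_p` (T-GAL (G-fib₀), token shape), and a target
adapter `t : (Fin n → QpModZp p) →+ E(ℚ̄)[p^∞]` (ℤ_p-linear, bijective, `t ([T_p σ]_b · v) = σ • t v` — ideator g42's ADAPTER-T): THERE IS the isogeny
`e₀` with `e₀ (fun i ↦ Σ_j constantCoeff ((ρ σ)ᵢⱼ) • v j) = W.primaryTorsionGaloisRep p σ (e₀ v)`, finite kernel and cokernel — the hypothesis `hfd₀` of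
`TelescopeBranchLatticeRestrict.branchLattice_conclusion_of_framed_rat`. [cite: Hida1986, Thm. 2.1 (2.2c)] -/
theorem exists_fd0_isogeny_of_conj_of_adapter {F : Type} [Field F] [NumberField F] (W : WeierstrassCurve F) [TopologicalSpace (PowerSeries ℤ_[p])]
    (ρ : FramedGaloisRep F (PowerSeries ℤ_[p]) n) (b : Module.Basis (Fin n) ℤ_[p] (W.tateModule p)) (P : GL (Fin n) ℚ_[p])
    (h : ∀ σ : Field.absoluteGaloisGroup F,
      (((ρ σ : GL (Fin n) (PowerSeries ℤ_[p])) : Matrix (Fin n) (Fin n) (PowerSeries ℤ_[p])).map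
          (fun G : PowerSeries ℤ_[p] => ((PowerSeries.constantCoeff G : ℤ_[p]) : ℚ_[p]))) =
        (P : Matrix (Fin n) (Fin n) ℚ_[p]) * (LinearMap.toMatrix b b (W.galoisRepTate p σ)).map ((↑) : ℤ_[p] → ℚ_[p]) *
          ((P⁻¹ : GL (Fin n) ℚ_[p]) : Matrix (Fin n) (Fin n) ℚ_[p]))
    (t : (Fin n → QpModZp p) →+ PrimaryTorsion W.geomPoints p)
    (htlin : ∀ (c : ℤ_[p]) (v : Fin n → QpModZp p), t (c • v) = c • t v) (htinj : Function.Injective t) (htsurj : Function.Surjective t)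
    (hteq : ∀ (σ : Field.absoluteGaloisGroup F) (v : Fin n → QpModZp p),
      t (fun i ↦ ∑ j, (LinearMap.toMatrix b b (W.galoisRepTate p σ)) i j • v j) = W.primaryTorsionGaloisRep p σ (t v)) :
    ∃ e₀ : (Fin n → QpModZp p) →+ PrimaryTorsion W.geomPoints p,
      (∀ (c : ℤ_[p]) (v : Fin n → QpModZp p), e₀ (c • v) = c • e₀ v) ∧
      (∀ (σ : Field.absoluteGaloisGroup F) (v : Fin n → QpModZp p),
        e₀ (fun i ↦ ∑ j, PowerSeries.constantCoeff
          (((ρ σ : GL (Fin n) (PowerSeries ℤ_[p])) : Matrix (Fin n) (Fin n) (PowerSeries ℤ_[p])) i j) • v j) =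
          W.primaryTorsionGaloisRep p σ (e₀ v)) ∧
      Finite e₀.ker ∧ Finite (PrimaryTorsion W.geomPoints p ⧸ e₀.range) := by
  have h' : ∀ σ : Field.absoluteGaloisGroup F,
      (((ρ σ : GL (Fin n) (PowerSeries ℤ_[p])) : Matrix (Fin n) (Fin n) (PowerSeries ℤ_[p])).map
          (PowerSeries.constantCoeff (R := ℤ_[p]))).map ((↑) : ℤ_[p] → ℚ_[p]) =
        (P : Matrix (Fin n) (Fin n) ℚ_[p]) * (LinearMap.toMatrix b b (W.galoisRepTate p σ)).map ((↑) : ℤ_[p] → ℚ_[p]) *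
          ((P⁻¹ : GL (Fin n) ℚ_[p]) : Matrix (Fin n) (Fin n) ℚ_[p]) := fun σ ↦ by
    rw [Matrix.map_map]; exact h σ
  obtain ⟨e₀, hlin, heq, hker, hcoker⟩ := exists_isogeny_of_conj_of_adapter
    (fun σ ↦ ((ρ σ : GL (Fin n) (PowerSeries ℤ_[p])) : Matrix (Fin n) (Fin n) (PowerSeries ℤ_[p])).map (PowerSeries.constantCoeff (R := ℤ_[p])))
    (fun σ ↦ LinearMap.toMatrix b b (W.galoisRepTate p σ)) P h' (fun σ a ↦ W.primaryTorsionGaloisRep p σ a) t htlin htinj htsurj hteq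
  exact ⟨e₀, hlin, fun σ v ↦ heq σ v, hker, hcoker⟩

end Summit.BirchSwinnertonDyer.BirchSwinnertonDyer.Theorems.TelescopeBranchCurveIsogenyOfConj

end
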